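import Literature.NumberTheory.DiophantineGeometry.MinimalDiscriminant
import HarnessLib

/-!
# The minimal discriminant of a Weierstrass curve — `𝔇_min = (Δ)` for a global minimal equation

Discharge of the named fact `WeierstrassCurve.minimalDiscriminantIdeal_eq_span` stated in
`Literature.NumberTheory.DiophantineGeometry.MinimalDiscriminant` (kept in a sibling file so that
the statement file stays a definitions/named-facts file, and separate from
`MinimalDiscriminantProofs` / `MinimalDiscriminantFiniteProofs`, which discharge neighbouring facts):
for a Weierstrass equation `W₀` with coefficients in the Dedekind domain `A` that is minimal at
every finite place `v` and has `Δ (W₀) ≠ 0`, the minimal discriminant ideal of `W₀ / K` is the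
principal ideal `(Δ (W₀))`.

## Proof (Silverman, AEC VIII.8, PDF p. 211, with VII.1 Prop. 1.3(b))

By definition `𝔇_min = ∏_v 𝔭_v ^ ord_v (Δ_v)` where `Δ_v` is the discriminant of a minimal equation
at `v`; and a nonzero ideal of a Dedekind domain is `∏_v 𝔭_v ^ ord_v` of itself
(`Ideal.finprod_heightOneSpectrum_factorization`). So it suffices to show, place by place, that
`ord_v (Δ_min) = ord_v (Δ (W₀))` when `W₀` is minimal at `v`
(`WeierstrassCurve.ordMinimalDiscriminant_baseChange_eq_count`). At a fixed `v`, both `W₀ ⊗ K_v`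
(by hypothesis) and the chosen local minimal model `(W₀ ⊗ K_v).minimal O_v` are minimal equations
related by a change of variables, so their discriminants have the same valuation (AEC VII.1,
Prop. 1.3(b); `WeierstrassCurve.valuation_Δ_minimal_eq_of_isMinimal`, the special case needed here
of `WeierstrassCurve.valuation_Δ_smul_eq_of_isMinimal` in `LocalReductionProofs`, reproved so that
this file does not depend on that sibling).
The remaining work is the bridge between the three valuations in play on `O_v ⊆ K_v`:
`IsDiscreteValuationRing.addVal O_v` (used by `WeierstrassCurve.ordMinimalDiscriminant`), the adic
valuation of the DVR `O_v` on its fraction field `K_v` (used by Mathlib's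
`WeierstrassCurve.IsMinimal`; equal values ⇒ associated elements,
`IsDiscreteValuationRing.associated_of_valuation_eq`), and `Valued.v` on `K_v`, which restricts to
`v.valuation K` on `K` (`WeierstrassCurve.addVal_adicCompletionIntegers_eq_of_valued_eq`: a
uniformizer `π ∈ K` of `v` is irreducible in `O_v`).

## References

* J. H. Silverman, *The Arithmetic of Elliptic Curves*, GTM 106, 2nd ed. 2009, §VIII.8, PDF p. 211
  (Definition of the minimal discriminant `𝒟_{E/K} = ∏_v 𝔭_v ^ ord_v (Δ_v)`; Definition of a global
  minimal Weierstrass equation: `aᵢ ∈ R` and `𝒟_{E/K} = (Δ)`), and §VII.1, PDF p. 165 (Definition of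
  the valuation of the minimal discriminant at `v`; Prop. 1.3(b)).
-/

open IsDedekindDomain

namespace WeierstrassCurve

section DVR

variable (R : Type*) [CommRing R] [IsDomain R] [IsDiscreteValuationRing R]
variable {K : Type*} [Field K] [Algebra R K] [IsFractionRing R K]

open IsDiscreteValuationRing IsDedekindDomain.HeightOneSpectrum

/-- If `W` is already a minimal Weierstrass equation over the DVR `R`, then Mathlib's chosen
minimal model `W.minimal R` (which is `C • W` for some change of variables `C`) has discriminant of
the same valuation as `W`: in Mathlib's formulation (`WeierstrassCurve.IsMinimal` = `MaximalFor` of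
`valuation_Δ_aux` on the linear order `{v : ℤᵐ⁰ // v ≤ 1}`) each of the two valuations bounds the
other (compare `W` with `C • W`, and `C • W` with `C⁻¹ • C • W = W`). Silverman, AEC VII.1,
Prop. 1.3(b) (the valuation of the minimal discriminant is well defined).
[cite: SilvermanAEC2009, VII.1 Prop. 1.3(b)] -/
theorem valuation_Δ_minimal_eq_of_isMinimal (W : WeierstrassCurve K) [hW : IsMinimal R W] :
    valuation K (maximalIdeal R) (W.minimal R).Δ = valuation K (maximalIdeal R) W.Δ := by
  set C := (W.exists_isMinimal R).choose
  have hC : IsMinimal R (C • W) := (W.exists_isMinimal R).choose_spec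
  change valuation K (maximalIdeal R) (C • W).Δ = _
  have h₁ := hW.val_Δ_maximal
  have h₂ := hC.val_Δ_maximal
  have hint₁ : IsIntegral R (C • W) := inferInstance
  have hint₂ : IsIntegral R (C⁻¹ • C • W) := by rw [inv_smul_smul]; infer_instance
  have e : valuation_Δ_aux R (C • W) = valuation_Δ_aux R W := by
    apply le_antisymm
    · rcases le_total (valuation_Δ_aux R ((1 : VariableChange K) • W))
        (valuation_Δ_aux R (C • W)) with h | h
      · simpa only [one_smul] using h₁.2 hint₁ h
      · simpa only [one_smul] using h
    · rcases le_total (valuation_Δ_aux R ((1 : VariableChange K) • C • W))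
        (valuation_Δ_aux R (C⁻¹ • C • W)) with h | h
      · simpa only [one_smul, inv_smul_smul] using h₂.2 hint₂ h
      · simpa only [one_smul, inv_smul_smul] using h
  have e' := congrArg Subtype.val e
  rwa [valuation_Δ_aux_eq_of_isIntegral, valuation_Δ_aux_eq_of_isIntegral] at e'

end DVR

section Bridge

variable {A : Type*} [CommRing A] [IsDedekindDomain A] {K : Type*} [Field K]
  [Algebra A K] [IsFractionRing A K] (v : HeightOneSpectrum A)

/-- An element of `O_v = v.adicCompletionIntegers K` of valuation `exp (-1)` (a uniformizer) is
irreducible in the DVR `O_v`: it is not a unit, and in a factorisation `a * b` the (integral)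
valuations of `a` and `b` add up to `-1`, so one of them is `0`. [folklore] -/
theorem irreducible_adicCompletionIntegers_of_valued_eq
    (ϖ : v.adicCompletionIntegers K)
    (hϖ : Valued.v (ϖ : v.adicCompletion K) = WithZero.exp (-1 : ℤ)) : Irreducible ϖ := by
  refine irreducible_iff.mpr ⟨?_, fun a b hab ↦ ?_⟩
  · rw [HeightOneSpectrum.adicCompletionIntegers.isUnit_iff_valued_eq_one, hϖ]
    exact ne_of_lt (by rw [← WithZero.exp_zero, WithZero.exp_lt_exp]; norm_num)
  · rw [HeightOneSpectrum.adicCompletionIntegers.isUnit_iff_valued_eq_one,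
      HeightOneSpectrum.adicCompletionIntegers.isUnit_iff_valued_eq_one]
    by_contra h
    obtain ⟨ha, hb⟩ := not_or.mp h
    have ha1 : Valued.v (a : v.adicCompletion K) < 1 := lt_of_le_of_ne a.2 ha
    have hb1 : Valued.v (b : v.adicCompletion K) < 1 := lt_of_le_of_ne b.2 hb
    have hab' : Valued.v (ϖ : v.adicCompletion K) =
        Valued.v (a : v.adicCompletion K) * Valued.v (b : v.adicCompletion K) := by
      rw [hab]; simp
    have ha0 : Valued.v (a : v.adicCompletion K) ≠ 0 := by
      intro h0; rw [h0, zero_mul, hϖ] at hab'; exact WithZero.exp_ne_zero hab'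
    have hb0 : Valued.v (b : v.adicCompletion K) ≠ 0 := by
      intro h0; rw [h0, mul_zero, hϖ] at hab'; exact WithZero.exp_ne_zero hab'
    obtain ⟨m, hm⟩ : ∃ m : ℤ, Valued.v (a : v.adicCompletion K) = WithZero.exp m :=
      ⟨_, (WithZero.exp_log ha0).symm⟩
    obtain ⟨n, hn⟩ : ∃ n : ℤ, Valued.v (b : v.adicCompletion K) = WithZero.exp n :=
      ⟨_, (WithZero.exp_log hb0).symm⟩
    rw [hm, hn, ← WithZero.exp_add, hϖ, WithZero.exp_inj] at hab'
    rw [hm, ← WithZero.exp_zero, WithZero.exp_lt_exp] at ha1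
    rw [hn, ← WithZero.exp_zero, WithZero.exp_lt_exp] at hb1
    omega

/-- Bridge between the additive valuation `IsDiscreteValuationRing.addVal` of the DVR
`O_v = v.adicCompletionIntegers K` and the valuation `Valued.v` of `K_v`: if `Valued.v r = exp (-n)`
then `addVal O_v r = n`. Proof: a uniformizer `π ∈ K` of `v` (`v (π) = exp (-1)`,
`IsDedekindDomain.HeightOneSpectrum.valuation_exists_uniformizer`) is irreducible in `O_v`
(`irreducible_adicCompletionIntegers_of_valued_eq`); write `r = u * π ^ m` with `u` a unit
(`IsDiscreteValuationRing.eq_unit_mul_pow_irreducible`), so `addVal r = m` and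
`Valued.v r = exp (-m)`. [folklore] -/
theorem addVal_adicCompletionIntegers_eq_of_valued_eq (r : v.adicCompletionIntegers K) (n : ℕ)
    (hr : Valued.v (r : v.adicCompletion K) = WithZero.exp (-(n : ℤ))) :
    IsDiscreteValuationRing.addVal (v.adicCompletionIntegers K) r = n := by
  obtain ⟨π, hπ⟩ := v.valuation_exists_uniformizer K
  set ϖ : v.adicCompletionIntegers K := ⟨(π : v.adicCompletion K), by
    rw [HeightOneSpectrum.mem_adicCompletionIntegers,
      HeightOneSpectrum.valuedAdicCompletion_eq_valuation', hπ, ← WithZero.exp_zero,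
      WithZero.exp_le_exp]; norm_num⟩ with hϖdef
  have hϖ : Valued.v (ϖ : v.adicCompletion K) = WithZero.exp (-1 : ℤ) := by
    simp only [ϖ]
    rw [HeightOneSpectrum.valuedAdicCompletion_eq_valuation', hπ]
  have hirr := irreducible_adicCompletionIntegers_of_valued_eq v ϖ hϖ
  have hr0 : r ≠ 0 := by
    rintro rfl
    rw [ZeroMemClass.coe_zero, map_zero] at hr
    exact WithZero.exp_ne_zero hr.symm
  obtain ⟨m, u, rfl⟩ := IsDiscreteValuationRing.eq_unit_mul_pow_irreducible hr0 hirr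
  rw [IsDiscreteValuationRing.addVal_def' u hirr m]
  have hu : Valued.v ((u : v.adicCompletionIntegers K) : v.adicCompletion K) = 1 :=
    (HeightOneSpectrum.adicCompletionIntegers.integers K v).valuation_unit u
  have : Valued.v (((u : v.adicCompletionIntegers K) * ϖ ^ m : v.adicCompletionIntegers K) :
      v.adicCompletion K) = WithZero.exp (-(m : ℤ)) := by
    push_cast
    rw [map_mul, map_pow, hu, hϖ, one_mul, ← WithZero.exp_nsmul]
    simp
  rw [this, WithZero.exp_inj] at hr
  exact_mod_cast neg_injective hr

end Bridge

section Discharge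

variable {A : Type*} [CommRing A] [IsDedekindDomain A] {K : Type*} [Field K]
  [Algebra A K] [IsFractionRing A K]

open IsDiscreteValuationRing in
/-- Per-place form of Silverman, AEC VIII.8: if the integral equation `W₀ / A` (with `Δ ≠ 0`) is
minimal at `v`, then `ord_v (Δ_min) = ord_v (Δ (W₀))`, the exponent of `𝔭_v` in the ideal
`(Δ (W₀))`. Silverman, AEC VII.1, PDF p. 165 (Definition of the valuation of the minimal
discriminant at `v`) and Prop. 1.3(b). [cite: SilvermanAEC2009, VII.1 Prop. 1.3(b)] -/
theorem ordMinimalDiscriminant_baseChange_eq_count (v : HeightOneSpectrum A)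
    (W₀ : WeierstrassCurve A) (hΔ : W₀.Δ ≠ 0) (h : (W₀.baseChange K).IsMinimalAt v) :
    (W₀.baseChange K).ordMinimalDiscriminant v =
      (Associates.mk v.asIdeal).count (Associates.mk (Ideal.span {W₀.Δ})).factors := by
  classical
  haveI : IsMinimal (v.adicCompletionIntegers K)
      ((W₀.baseChange K).baseChange (v.adicCompletion K)) := h
  -- Step 1: the chosen local minimal model and `W₀` have discriminants of equal valuation.
  have h1 : HeightOneSpectrum.valuation (v.adicCompletion K)
        (maximalIdeal (v.adicCompletionIntegers K)) ((W₀.baseChange K).localMinimalModel v).Δ =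
      HeightOneSpectrum.valuation (v.adicCompletion K)
        (maximalIdeal (v.adicCompletionIntegers K))
        ((W₀.baseChange K).baseChange (v.adicCompletion K)).Δ :=
    valuation_Δ_minimal_eq_of_isMinimal (v.adicCompletionIntegers K) _
  -- Step 2: pass to elements of `O_v`; equal valuation means associated, hence equal `addVal`.
  have hI : algebraMap (v.adicCompletionIntegers K) (v.adicCompletion K)
      ((W₀.baseChange K).localMinimalIntegralModel v).Δ =
      ((W₀.baseChange K).localMinimalModel v).Δ :=
    integralModel_Δ_eq (v.adicCompletionIntegers K) _
  set d : v.adicCompletionIntegers K := algebraMap A (v.adicCompletionIntegers K) W₀.Δ with hd_def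
  have hdL : algebraMap (v.adicCompletionIntegers K) (v.adicCompletion K) d =
      ((algebraMap A K W₀.Δ : K) : v.adicCompletion K) := by
    rw [hd_def, ← IsScalarTower.algebraMap_apply, HeightOneSpectrum.algebraMap_adicCompletion]
    rfl
  have hd : algebraMap (v.adicCompletionIntegers K) (v.adicCompletion K) d =
      ((W₀.baseChange K).baseChange (v.adicCompletion K)).Δ := by
    rw [hdL]
    simp only [baseChange, map_Δ, HeightOneSpectrum.algebraMap_adicCompletion]
    rfl
  have h2 : Associated ((W₀.baseChange K).localMinimalIntegralModel v).Δ d := by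
    obtain ⟨u, hu⟩ := associated_of_valuation_eq
      (algebraMap _ (v.adicCompletion K) ((W₀.baseChange K).localMinimalIntegralModel v).Δ)
      (algebraMap _ (v.adicCompletion K) d) (by rw [hI, hd]; exact h1)
    refine ⟨u, FaithfulSMul.algebraMap_injective _ (v.adicCompletion K) ?_⟩
    rw [← hu, Units.smul_def, Algebra.smul_def, map_mul, mul_comm]
  have h3 : addVal (v.adicCompletionIntegers K) ((W₀.baseChange K).localMinimalIntegralModel v).Δ =
      addVal (v.adicCompletionIntegers K) d :=
    (addVal_eq_iff_associated _ _).mpr h2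
  -- Step 3: `addVal O_v (Δ (W₀)) = ord_v (Δ (W₀))` via `Valued.v = v.valuation K` on `K`.
  have h4 : addVal (v.adicCompletionIntegers K) d =
      (Associates.mk v.asIdeal).count (Associates.mk (Ideal.span {W₀.Δ})).factors := by
    apply addVal_adicCompletionIntegers_eq_of_valued_eq v d
    change Valued.v (algebraMap (v.adicCompletionIntegers K) (v.adicCompletion K) d) = _
    rw [hdL, HeightOneSpectrum.valuedAdicCompletion_eq_valuation',
      HeightOneSpectrum.valuation_of_algebraMap, HeightOneSpectrum.intValuation_if_neg _ hΔ]
  rw [ordMinimalDiscriminant, h3, h4]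
  rfl

variable (A)

/-- **Discharge** of the named fact `WeierstrassCurve.minimalDiscriminantIdeal_eq_span`: for a
global minimal Weierstrass equation `W₀ / A` (coefficients in `A`, minimal at every finite place,
`Δ ≠ 0`), `𝔇_min = (Δ (W₀))`. Silverman, AEC VIII.8, PDF p. 211: Definition of the minimal
discriminant `𝒟_{E/K} = ∏_v 𝔭_v ^ ord_v (Δ_v)` and Definition of a global minimal Weierstrass
equation (`aᵢ ∈ R` and `𝒟_{E/K} = (Δ)`), i.e. `ord_v (Δ_v) = ord_v (Δ)` at every `v`
(`ordMinimalDiscriminant_baseChange_eq_count`, from VII.1 Prop. 1.3(b)) plus unique factorisation of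
ideals (`Ideal.finprod_heightOneSpectrum_factorization`).
[cite: SilvermanAEC2009, VIII.8 (Definitions preceding Lemma 8.1, PDF p. 211)] -/
theorem minimalDiscriminantIdeal_eq_span_holds : minimalDiscriminantIdeal_eq_span A (K := K) := by
  intro W₀ hΔ h
  have hI : Ideal.span {W₀.Δ} ≠ 0 := by
    rw [Ne, Ideal.zero_eq_bot, Ideal.span_singleton_eq_bot]; exact hΔ
  rw [minimalDiscriminantIdeal, ← Ideal.finprod_heightOneSpectrum_factorization hI]
  refine finprod_congr fun v ↦ ?_
  rw [ordMinimalDiscriminant_baseChange_eq_count v W₀ hΔ (h v)]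
  rfl

end Discharge

end WeierstrassCurve
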